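import Literature.NumberTheory.Transcendental.GenusZeroPeriodsMZVDimTwoSeriesProofs
import Literature.NumberTheory.Transcendental.GenusZeroPeriodsMZVLowDimProofs
import Mathlib.Algebra.Polynomial.Div
import Mathlib.Algebra.Polynomial.Roots
import HarnessLib

/-!
# Brown's theorem on the periods of `𝔐_{0,5}`: the case of dimension `2`

Third companion file of the named fact
`Literature.NumberTheory.Transcendental.GenusZeroPeriodsMZV` (Brown's theorem: an absolutely
convergent integral over the standard cell of a regular function
`P/(∏ tᵢ^{bᵢ} ∏ (1-tᵢ)^{cᵢ} ∏_{i<j} (tᵢ-tⱼ)^{aᵢⱼ})` on `𝔐_{0,ℓ+3}` lies in `∑_{w ≤ ℓ} 𝒵_w`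
[Brown, Ann. Sci. ÉNS 42 (2009), Thm 1.1, Cor 8.3]). `GenusZeroPeriodsMZVLowDimProofs.lean`
proves `ℓ = 0, 1`; `GenusZeroPeriodsMZVDimTwoSeriesProofs.lean` evaluates the convergent
dihedral monomial integrals of `𝔐_{0,5}` (Thm 8.2 for `|S| = 5`). This file proves the case
`ℓ = 2` verbatim in the shape of the fact (`GenusZeroPeriodsMZV.integral_mem_iSup_mzvSpace_two`)
and assembles `integral_mem_iSup_mzvSpace_of_le_two`.

## The argument ([Brown 2009, §7.2 Lemma 7.4 with Lemma 4.9, for the pentagon `X̄₅`])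

Write the integrand in the coordinates `p = (y, x) = (t₀, t₁)` of the triangle
`T = {0 < x < y < 1}` as `P(y,x)/(y^{b₀} x^{b₁} (1-y)^{c₀} (1-x)^{c₁} (y-x)^a)` with
`P ∈ ℚ[y][x] = ℚ[X][X]` (outer variable `x`; the *section* of `P` at the real height `y` is
`P_y = P.map (eval₂RingHom (algebraMap ℚ ℝ) y) ∈ ℝ[x]`). The closure of the cell in `𝔐̄_{0,5}(ℝ)`
is a pentagon: the three edges `x = 0`, `x = y`, `y = 1` of the triangle and the exceptional
divisors over the corners `(0,0)` and `(1,1)`; absolute convergence is the absence of poles along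
these five divisors (Lemma 4.9), and we extract exactly this:

* **Edges** (`exists_reduce_edges`, `exists_reduce_edge_one`): by Fubini almost every section
  `x ↦ F(y,x)` is integrable on `(0,y)`, so the one-variable pole lemma
  (`X_sub_C_pow_dvd_of_integrableOn_unit`, from `not_integrableOn_Ioo_zpow_mul`) gives
  `x^{b₁} ∣ P_y` and `(x-y)^a ∣ P_y` for a.e. `y`; divisibility by a MONIC polynomial of
  `ℚ[y][x]` lifts from almost every section to `ℚ[y][x]` (`dvd_of_ae_section_dvd`: the remainder
  `P %ₘ Q` has coefficients with infinitely many real roots). The edge `y = 1` is the edge `x = 0`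
  of the reflected data: the involution `σP(y,x) = P(1-x,1-y)` of `ℚ[y][x]`
  (`section_sigma`, `sigma_sigma`) and the measure-preserving involution
  `s(y,x) = (1-x,1-y)` of `T` exchange the exponents `(b₀,b₁,c₀,c₁,a) ↦ (c₁,c₀,b₁,b₀,a)`
  (`integrand_symm_apply`, `integrableOn_symm_iff`). Outcome: the integrand equals
  `D(y,x)/(y^{b₀} (1-x)^{c₁})` on `T`.
* **Corners** (`coeff_eq_zero_of_corner`, `coeff_sigma_eq_zero_of_corner`): blowing up
  `x = u y`, Tonelli and the scaling of the inner variable show that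
  `(y,u) ↦ y D(y,uy)/(y^{b₀} (1-uy)^{c₁})` is integrable on the unit square, so for a.e. `u`
  the pole lemma in `y` gives `y^{b₀-1} ∣ Π_u` (`Π_u(y) = D(y,uy)`), i.e. the low coefficients
  `Θ_m(u) = ∑_j c_{m-j,j} uʲ` vanish for infinitely many `u`: `c_{ij} = 0` for
  `i + j + 1 < b₀` (order `≥ b₀ - 1` at `(0,0)`); at `(1,1)` through `σ`.
* **Spanning and value** (`integral_mem_of_orders`): with a Bézout identity
  `A x^{b₀-1} + A' (1-x)^{c₁-1} = 1` in `ℚ[x]`, the two vanishing orders write the integrand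
  as a finite rational combination of the monomials `xⁱ y^J (1-x)^K (1-y)^l`, `i + J ≥ -1`,
  `K + l ≥ -1`, of `integral_monomial_mem` (this is Lemma 7.4: a convergent form is a
  combination of dihedral monomials `∏ u_{ij}^{α_{ij}} ω`, `α ≥ 0`), whose integrals lie in
  `ℚ + ℚ ζ(2) = 𝒵₀ + 𝒵₁ + 𝒵₂` (Thm 8.2).
* **Transfer** (`integral_mem_iSup_mzvSpace_two`): `MeasurableEquiv.finTwoArrow` carries
  `KZ.openOrderedSimplex 2 ⊆ ℝ^{Fin 2}` onto `T` (volume preserving), and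
  `MvPolynomial (Fin 2) ℚ` into `ℚ[X][X]` (`aeval_eq_eval_section`).

References: F. Brown, *Multiple zeta values and periods of moduli spaces `𝔐̄_{0,n}`*, Ann. Sci.
ÉNS 42 (2009) 371–489: Thm 1.1, §2.2 (the cell `X₅` is a pentagon), Lemma 4.9, Lemma 7.4,
Thm 8.2, Cor 8.3.
-/

noncomputable section

open MeasureTheory Set Filter Polynomial
open scoped Topology Polynomial ENNReal

namespace Literature.NumberTheory.Transcendental

namespace GenusZeroPeriodsMZV

/-! ### Two-variable rational polynomials as `ℚ[X][X]`: the section at height `y`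

A polynomial `P ∈ ℚ[y][x]` is an element of `ℚ[X][X]` (outer variable `x`, inner variable `y`,
written `C X`). Its *section* at the real height `y` is the real polynomial in `x`
`P_y = P.map (eval₂RingHom (algebraMap ℚ ℝ) y) ∈ ℝ[X]`, and the value of `P` at `(y, x)` is
`P_y.eval x`. -/

/-- Coefficients of the section: `(P_y)_j = (P_j)(y)`. [folklore] -/
theorem coeff_section (P : ℚ[X][X]) (y : ℝ) (j : ℕ) :
    (P.map (eval₂RingHom (algebraMap ℚ ℝ) y)).coeff j = aeval y (P.coeff j) := by
  rw [coeff_map, coe_eval₂RingHom, aeval_def]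

/-- The section of a product. [folklore] -/
theorem section_mul (P Q : ℚ[X][X]) (y : ℝ) :
    (P * Q).map (eval₂RingHom (algebraMap ℚ ℝ) y) =
      P.map (eval₂RingHom (algebraMap ℚ ℝ) y) * Q.map (eval₂RingHom (algebraMap ℚ ℝ) y) :=
  Polynomial.map_mul _

/-- The section of `X^n` is `X^n`. [folklore] -/
theorem section_X_pow (y : ℝ) (n : ℕ) :
    ((X : ℚ[X][X]) ^ n).map (eval₂RingHom (algebraMap ℚ ℝ) y) = X ^ n := by
  rw [Polynomial.map_pow, map_X]

/-- The section of `(X - C X)^n` (i.e. of `(x - y)^n`) is `(X - C y)^n`. [folklore] -/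
theorem section_X_sub_C_X_pow (y : ℝ) (n : ℕ) :
    ((X - C (X : ℚ[X]) : ℚ[X][X]) ^ n).map (eval₂RingHom (algebraMap ℚ ℝ) y) = (X - C y) ^ n := by
  rw [Polynomial.map_pow, Polynomial.map_sub, map_X, map_C, coe_eval₂RingHom, eval₂_X]

/-- The section of a constant `(-1)^n`. [folklore] -/
theorem section_neg_one_pow (y : ℝ) (n : ℕ) :
    ((-1 : ℚ[X][X]) ^ n).map (eval₂RingHom (algebraMap ℚ ℝ) y) = (-1) ^ n := by
  rw [Polynomial.map_pow, Polynomial.map_neg, Polynomial.map_one]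

/-! ### From almost every height to all heights -/

/-- A property holding for almost every `y ∈ (0, 1)` holds on an infinite set. [folklore] -/
theorem infinite_of_ae_Ioo {Q : ℝ → Prop}
    (h : ∀ᵐ y ∂(volume.restrict (Ioo (0 : ℝ) 1)), Q y) : Set.Infinite {y | Q y} := by
  intro hfin
  have h1 : (volume.restrict (Ioo (0 : ℝ) 1)) {y | ¬Q y} = 0 := ae_iff.1 h
  have h2 : (volume.restrict (Ioo (0 : ℝ) 1)) {y | Q y} = 0 :=
    nonpos_iff_eq_zero.1 (((Measure.le_iff'.1 Measure.restrict_le_self _).trans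
      (hfin.measure_zero volume).le))
  have h3 : (volume.restrict (Ioo (0 : ℝ) 1)) univ = 0 := by
    have hu : (univ : Set ℝ) = {y | Q y} ∪ {y | ¬Q y} := by
      ext y; simp [em]
    rw [hu]
    exact nonpos_iff_eq_zero.1 ((measure_union_le _ _).trans (by rw [h1, h2, add_zero]))
  rw [Measure.restrict_apply_univ, Real.volume_Ioo] at h3
  simp at h3

/-- **Lifting divisibility from the sections.** If `Q ∈ ℚ[y][x]` is monic in `x` and the
section `Q_y` divides the section `P_y` in `ℝ[x]` for almost every `y ∈ (0,1)`, then `Q ∣ P`: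
the remainder `P %ₘ Q` has all its sections zero at those heights, so its coefficients,
rational polynomials in `y` with infinitely many real roots, vanish. [folklore] -/
theorem dvd_of_ae_section_dvd {Q P : ℚ[X][X]} (hQ : Q.Monic)
    (h : ∀ᵐ y ∂(volume.restrict (Ioo (0 : ℝ) 1)),
      Q.map (eval₂RingHom (algebraMap ℚ ℝ) y) ∣ P.map (eval₂RingHom (algebraMap ℚ ℝ) y)) :
    Q ∣ P := by
  rw [← modByMonic_eq_zero_iff_dvd hQ]
  ext j : 1
  rw [coeff_zero]
  have hroots : Set.Infinite {y : ℝ | IsRoot (((P %ₘ Q).coeff j).map (algebraMap ℚ ℝ)) y} := by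
    refine infinite_of_ae_Ioo (h.mono fun y hy => ?_)
    have h0 : (P %ₘ Q).map (eval₂RingHom (algebraMap ℚ ℝ) y) = 0 := by
      rw [map_modByMonic _ hQ, modByMonic_eq_zero_iff_dvd (hQ.map _)]
      exact hy
    have := congrArg (fun R : ℝ[X] => R.coeff j) h0
    simp only [coeff_section, coeff_zero] at this
    rwa [IsRoot.def, eval_map, ← aeval_def]
  have hz := eq_zero_of_infinite_isRoot _ hroots
  rwa [Polynomial.map_eq_zero_iff (algebraMap ℚ ℝ).injective] at hz

/-! ### The one-dimensional pole lemma (general unit factor) -/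

/-- **Absolute convergence across `x₀` forces divisibility by `(X - x₀)^k`.** If
`x ↦ P(x) / ((x - x₀)^k ψ(x))` is integrable on an interval `(u, v)` with `x₀ ∈ [u, v]`, where
`ψ` is continuous at `x₀` with `ψ(x₀) ≠ 0`, then `(X - x₀)^k ∣ P`; otherwise the integrand is
`(x - x₀)^{v-k} φ(x)` with `v < k`, `φ(x₀) ≠ 0`, a pole of integer order
(`not_integrableOn_Ioo_zpow_mul`). The one-variable case of [Brown 2009, Lemma 7.4 / 4.9].
[folklore] -/
theorem X_sub_C_pow_dvd_of_integrableOn_unit {P : ℝ[X]} {k : ℕ} {x₀ u v : ℝ} (huv : u < v)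
    (hx₀ : x₀ ∈ uIcc u v) {ψ : ℝ → ℝ} (hψ : ContinuousAt ψ x₀) (hψ0 : ψ x₀ ≠ 0)
    (h : IntegrableOn (fun x : ℝ => P.eval x / ((x - x₀) ^ k * ψ x)) (Ioo u v) volume) :
    (X - C x₀) ^ k ∣ P := by
  rcases eq_or_ne P 0 with rfl | hP
  · exact dvd_zero _
  obtain ⟨Q, hPQ, hQ⟩ := P.exists_eq_pow_rootMultiplicity_mul_and_not_dvd hP x₀
  set w := P.rootMultiplicity x₀ with hw
  by_cases hkw : k ≤ w
  · rw [hPQ]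
    exact Dvd.dvd.mul_right (pow_dvd_pow _ hkw) Q
  exfalso
  push Not at hkw
  have hQ0 : Q.eval x₀ ≠ 0 := by
    rwa [dvd_iff_isRoot, IsRoot.def] at hQ
  have hEq : EqOn (fun x : ℝ => P.eval x / ((x - x₀) ^ k * ψ x))
      (fun x => (x - x₀) ^ ((w : ℤ) - k) * (Q.eval x / ψ x)) (Ioo u v) := by
    intro x _
    simp only
    rcases eq_or_ne x x₀ with rfl | hx
    · have hk0 : k ≠ 0 := by omega
      rw [sub_self, zero_pow hk0, zero_mul, div_zero, zero_zpow _ (by omega), zero_mul]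
    · have hx' : x - x₀ ≠ 0 := sub_ne_zero.2 hx
      rw [hPQ, eval_mul, eval_pow, eval_sub, eval_X, eval_C, zpow_sub₀ hx', zpow_natCast,
        zpow_natCast]
      field_simp
  refine not_integrableOn_Ioo_zpow_mul (k := (w : ℤ) - k) (by omega) ?_ ?_ huv hx₀
    (h.congr_fun hEq measurableSet_Ioo)
  · exact Q.continuousAt.div hψ hψ0
  · exact div_ne_zero hQ0 hψ0

/-! ### Sections of an integrable function on the triangle -/

/-- If `F` is integrable on the triangle `{0 < x < y < 1}` then for almost every height
`y ∈ (0,1)` the section `x ↦ F(y, x)` is integrable on `(0, y)` (Fubini). [folklore] -/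
theorem ae_integrableOn_section {F : ℝ × ℝ → ℝ}
    (h : IntegrableOn F {p : ℝ × ℝ | 0 < p.2 ∧ p.2 < p.1 ∧ p.1 < 1} volume) :
    ∀ᵐ y ∂(volume.restrict (Ioo (0 : ℝ) 1)), IntegrableOn (fun x => F (y, x)) (Ioo 0 y) volume := by
  have h1 : Integrable (({p : ℝ × ℝ | 0 < p.2 ∧ p.2 < p.1 ∧ p.1 < 1} : Set (ℝ × ℝ)).indicator F)
      ((volume : Measure ℝ).prod volume) := by
    rw [← Measure.volume_eq_prod]
    exact (integrable_indicator_iff measurableSet_triangle).2 h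
  have h2 : ∀ᵐ y ∂(volume.restrict (Ioo (0 : ℝ) 1)), Integrable (fun x =>
      ({p : ℝ × ℝ | 0 < p.2 ∧ p.2 < p.1 ∧ p.1 < 1} : Set (ℝ × ℝ)).indicator F (y, x)) volume :=
    ae_restrict_of_ae h1.prod_right_ae
  filter_upwards [ae_restrict_mem measurableSet_Ioo, h2] with y hy hy'
  have heq : (fun x => ({p : ℝ × ℝ | 0 < p.2 ∧ p.2 < p.1 ∧ p.1 < 1} : Set (ℝ × ℝ)).indicator F
      (y, x)) = (Ioo 0 y).indicator (fun x => F (y, x)) := by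
    funext x
    by_cases hx : x ∈ Ioo 0 y
    · rw [indicator_of_mem hx,
        indicator_of_mem (show (y, x) ∈ ({p : ℝ × ℝ | 0 < p.2 ∧ p.2 < p.1 ∧ p.1 < 1} :
          Set (ℝ × ℝ)) from ⟨hx.1, hx.2, hy.2⟩)]
    · rw [indicator_of_notMem hx, indicator_of_notMem]
      exact fun hm => hx ⟨hm.1, hm.2.1⟩
  rw [heq, integrable_indicator_iff measurableSet_Ioo] at hy'
  exact hy'

/-! ### Step 1: the edges `x = 0` and `x = y`

Absolute convergence forces `x^{b₁} ∣ P` and `(y - x)^a ∣ P`: the integrand is then that of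
the data `(D, b₀, 0, c₀, c₁, 0)`. -/

/-- **Edges `x = 0` and `x = y`.** If `P(y,x)/(y^{b₀} x^{b₁} (1-y)^{c₀} (1-x)^{c₁} (y-x)^a)` is
integrable on the triangle, then `x^{b₁} (x - y)^a ∣ P` in `ℚ[y][x]`, so that on the triangle
the integrand equals `D(y,x)/(y^{b₀} x^0 (1-y)^{c₀} (1-x)^{c₁} (y-x)^0)` for some `D ∈ ℚ[y][x]`
(sections at a.e. height, the 1-D pole lemma at `x₀ = 0` and `x₀ = y`, lifting).
[Brown 2009, Lemma 7.4 (|S| = 5)] [folklore] -/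
theorem exists_reduce_edges (P : ℚ[X][X]) (b₀ b₁ c₀ c₁ a : ℕ)
    (h : IntegrableOn (fun p : ℝ × ℝ =>
        (P.map (eval₂RingHom (algebraMap ℚ ℝ) p.1)).eval p.2 /
          (p.1 ^ b₀ * p.2 ^ b₁ * (1 - p.1) ^ c₀ * (1 - p.2) ^ c₁ * (p.1 - p.2) ^ a))
        {p : ℝ × ℝ | 0 < p.2 ∧ p.2 < p.1 ∧ p.1 < 1} volume) :
    ∃ D : ℚ[X][X], ∀ p ∈ ({p : ℝ × ℝ | 0 < p.2 ∧ p.2 < p.1 ∧ p.1 < 1} : Set (ℝ × ℝ)),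
      (P.map (eval₂RingHom (algebraMap ℚ ℝ) p.1)).eval p.2 /
          (p.1 ^ b₀ * p.2 ^ b₁ * (1 - p.1) ^ c₀ * (1 - p.2) ^ c₁ * (p.1 - p.2) ^ a) =
        (D.map (eval₂RingHom (algebraMap ℚ ℝ) p.1)).eval p.2 /
          (p.1 ^ b₀ * p.2 ^ 0 * (1 - p.1) ^ c₀ * (1 - p.2) ^ c₁ * (p.1 - p.2) ^ 0) := by
  have hsec := ae_integrableOn_section h
  -- divisibility of almost every section
  have hdvd : ∀ᵐ y ∂(volume.restrict (Ioo (0 : ℝ) 1)),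
      (X : ℝ[X]) ^ b₁ ∣ P.map (eval₂RingHom (algebraMap ℚ ℝ) y) ∧
        (X - C y) ^ a ∣ P.map (eval₂RingHom (algebraMap ℚ ℝ) y) := by
    refine ((ae_restrict_mem measurableSet_Ioo).and hsec).mono fun y ⟨hy, hy'⟩ => ⟨?_, ?_⟩
    · -- pole at `x₀ = 0`
      have h0 := X_sub_C_pow_dvd_of_integrableOn_unit (P := P.map (eval₂RingHom (algebraMap ℚ ℝ) y))
        (k := b₁) (x₀ := 0) hy.1 left_mem_uIcc
        (ψ := fun x => y ^ b₀ * (1 - y) ^ c₀ * (1 - x) ^ c₁ * (y - x) ^ a)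
        (by fun_prop) (by simp [hy.1.ne', (sub_pos.2 hy.2).ne']) ?_
      · simpa using h0
      · refine hy'.congr_fun (fun x _ => ?_) measurableSet_Ioo
        dsimp only
        rw [sub_zero]
        ring
    · -- pole at `x₀ = y`
      have h0 := X_sub_C_pow_dvd_of_integrableOn_unit (P := P.map (eval₂RingHom (algebraMap ℚ ℝ) y))
        (k := a) (x₀ := y) hy.1 right_mem_uIcc
        (ψ := fun x => y ^ b₀ * x ^ b₁ * (1 - y) ^ c₀ * (1 - x) ^ c₁ * (-1) ^ a)
        (by fun_prop) (by simp [hy.1.ne', (sub_pos.2 hy.2).ne']) ?_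
      · exact h0
      · refine hy'.congr_fun (fun x _ => ?_) measurableSet_Ioo
        have : (y - x) ^ a = (-1) ^ a * (x - y) ^ a := by rw [← mul_pow]; ring_nf
        dsimp only
        rw [this]
        ring
  -- lifting: `X^{b₁} ∣ P`
  have hX : (X : ℚ[X][X]) ^ b₁ ∣ P := by
    refine dvd_of_ae_section_dvd (monic_X.pow b₁) (hdvd.mono fun y hy => ?_)
    rw [section_X_pow]
    exact hy.1
  obtain ⟨P₁, rfl⟩ := hX
  -- lifting: `(X - C X)^a ∣ P₁`, using coprimality of `X` and `X - C y` for `y ≠ 0`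
  have hXy : (X - C (X : ℚ[X]) : ℚ[X][X]) ^ a ∣ P₁ := by
    refine dvd_of_ae_section_dvd ((monic_X_sub_C _).pow a)
      (((ae_restrict_mem measurableSet_Ioo).and hdvd).mono fun y hy => ?_)
    obtain ⟨hy, -, hy2⟩ := hy
    rw [section_X_sub_C_X_pow]
    rw [section_mul, section_X_pow] at hy2
    have hcop : IsCoprime ((X - C y) ^ a) ((X : ℝ[X]) ^ b₁) := by
      refine IsCoprime.pow ⟨C (-y⁻¹), C y⁻¹, ?_⟩
      have hy0 : (y : ℝ) ≠ 0 := hy.1.ne'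
      calc C (-y⁻¹) * (X - C y) + C y⁻¹ * X = C (y⁻¹ * y) := by
            simp only [map_mul, map_neg]; ring
        _ = 1 := by rw [inv_mul_cancel₀ hy0, map_one]
    exact hcop.dvd_of_dvd_mul_left hy2
  obtain ⟨D, rfl⟩ := hXy
  refine ⟨(-1) ^ a * D, fun p hp => ?_⟩
  have hx0 : p.2 ≠ 0 := hp.1.ne'
  have hxy : p.1 - p.2 ≠ 0 := sub_ne_zero.2 hp.2.1.ne'
  have hy0 : p.1 ≠ 0 := (hp.1.trans hp.2.1).ne'
  have hy1 : 1 - p.1 ≠ 0 := sub_ne_zero.2 hp.2.2.ne'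
  have hx1 : 1 - p.2 ≠ 0 := sub_ne_zero.2 (hp.2.1.trans hp.2.2).ne'
  simp only [section_mul, section_X_pow, section_X_sub_C_X_pow, section_neg_one_pow, eval_mul,
    eval_pow, eval_X, eval_sub, eval_C, eval_neg, eval_one, pow_zero, mul_one]
  have : (p.2 - p.1) ^ a = (-1) ^ a * (p.1 - p.2) ^ a := by rw [← mul_pow]; ring_nf
  rw [this]
  field_simp

/-! ### The symmetry `(y, x) ↦ (1 - x, 1 - y)` of the triangle

On polynomials: `σP(y, x) = P(1 - x, 1 - y)`, the ring endomorphism of `ℚ[X][X]` sending the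
outer variable `X ↦ C (1 - X)` and the inner one `C X ↦ 1 - X`; it is an involution, and it
exchanges the exponent data `(b₀, b₁, c₀, c₁, a) ↦ (c₁, c₀, b₁, b₀, a)`. On the plane:
`s(y, x) = (1 - x, 1 - y)` preserves Lebesgue measure and the triangle. -/

/-- Values of `σP`: `(σP)(y, x) = P(1 - x, 1 - y)`. [folklore] -/
theorem section_sigma (P : ℚ[X][X]) (y x : ℝ) :
    ((eval₂RingHom (eval₂RingHom ((C : ℚ[X] →+* ℚ[X][X]).comp (C : ℚ →+* ℚ[X])) (1 - X))
        (C (1 - X)) P).map (eval₂RingHom (algebraMap ℚ ℝ) y)).eval x =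
      (P.map (eval₂RingHom (algebraMap ℚ ℝ) (1 - x))).eval (1 - y) := by
  have inner : ((evalRingHom x).comp ((mapRingHom (eval₂RingHom (algebraMap ℚ ℝ) y)).comp
      (eval₂RingHom ((C : ℚ[X] →+* ℚ[X][X]).comp (C : ℚ →+* ℚ[X])) (1 - X)))) =
      eval₂RingHom (algebraMap ℚ ℝ) (1 - x) := by
    refine Polynomial.ringHom_ext (fun c => ?_) ?_
    · simp
    · simp
  have outer : ((evalRingHom x).comp (mapRingHom (eval₂RingHom (algebraMap ℚ ℝ) y))).comp
      (eval₂RingHom (eval₂RingHom ((C : ℚ[X] →+* ℚ[X][X]).comp (C : ℚ →+* ℚ[X])) (1 - X))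
        (C (1 - X))) =
      (evalRingHom (1 - y)).comp (mapRingHom (eval₂RingHom (algebraMap ℚ ℝ) (1 - x))) := by
    refine Polynomial.ringHom_ext (fun r => ?_) ?_
    · have := congrArg (fun φ : ℚ[X] →+* ℝ => φ r) inner
      simp only [RingHom.comp_apply, coe_eval₂RingHom, eval₂_C, coe_mapRingHom,
        coe_evalRingHom] at this ⊢
      rw [this, map_C, eval_C, coe_eval₂RingHom]
    · simp
  have := congrArg (fun φ : ℚ[X][X] →+* ℝ => φ P) outer
  simpa using this

/-- `σ` is an involution of `ℚ[y][x]`. [folklore] -/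
theorem sigma_sigma (P : ℚ[X][X]) :
    (eval₂RingHom (eval₂RingHom ((C : ℚ[X] →+* ℚ[X][X]).comp (C : ℚ →+* ℚ[X])) (1 - X))
        (C (1 - X)))
      ((eval₂RingHom (eval₂RingHom ((C : ℚ[X] →+* ℚ[X][X]).comp (C : ℚ →+* ℚ[X])) (1 - X))
        (C (1 - X))) P) = P := by
  set σ : ℚ[X][X] →+* ℚ[X][X] := eval₂RingHom
    (eval₂RingHom ((C : ℚ[X] →+* ℚ[X][X]).comp (C : ℚ →+* ℚ[X])) (1 - X)) (C (1 - X)) with hσ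
  have hσX : σ X = C (1 - X) := by simp [hσ]
  have hσC : ∀ r : ℚ[X], σ (C r) = eval₂ ((C : ℚ[X] →+* ℚ[X][X]).comp (C : ℚ →+* ℚ[X])) (1 - X) r := by
    intro r; simp [hσ]
  have hσCC : ∀ c : ℚ, σ (C (C c)) = C (C c) := by
    intro c; rw [hσC, eval₂_C, RingHom.comp_apply]
  have hσCX : σ (C X) = 1 - X := by rw [hσC, eval₂_X]
  have inner : (σ.comp σ).comp (C : ℚ[X] →+* ℚ[X][X]) = C := by
    refine Polynomial.ringHom_ext (fun c => ?_) ?_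
    · simp only [RingHom.comp_apply, hσCC]
    · simp only [RingHom.comp_apply, hσCX, map_sub, map_one, hσX]
      ring
  have outer : σ.comp σ = RingHom.id _ := by
    refine Polynomial.ringHom_ext (fun r => ?_) ?_
    · exact congrArg (fun φ : ℚ[X] →+* ℚ[X][X] => φ r) inner
    · simp only [RingHom.comp_apply, hσX, RingHom.id_apply, map_sub, map_one, hσCX]
      ring
  exact congrArg (fun φ : ℚ[X][X] →+* ℚ[X][X] => φ P) outer

/-- **The symmetry exchanges the exponent data.** At `s(y,x) = (1 - x, 1 - y)` the integrand
of the data `(P, b₀, b₁, c₀, c₁, a)` takes the value of the integrand of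
`(σP, c₁, c₀, b₁, b₀, a)` at `(y, x)` (note `(1-x) - (1-y) = y - x`). [folklore] -/
theorem integrand_symm_apply (P : ℚ[X][X]) (b₀ b₁ c₀ c₁ a : ℕ) (p : ℝ × ℝ) :
    (P.map (eval₂RingHom (algebraMap ℚ ℝ) (1 - p.2))).eval (1 - p.1) /
        ((1 - p.2) ^ b₀ * (1 - p.1) ^ b₁ * (1 - (1 - p.2)) ^ c₀ * (1 - (1 - p.1)) ^ c₁ *
          ((1 - p.2) - (1 - p.1)) ^ a) =
      ((eval₂RingHom (eval₂RingHom ((C : ℚ[X] →+* ℚ[X][X]).comp (C : ℚ →+* ℚ[X])) (1 - X))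
          (C (1 - X)) P).map (eval₂RingHom (algebraMap ℚ ℝ) p.1)).eval p.2 /
        (p.1 ^ c₁ * p.2 ^ c₀ * (1 - p.1) ^ b₁ * (1 - p.2) ^ b₀ * (p.1 - p.2) ^ a) := by
  rw [section_sigma]
  congr 1
  ring

/-- The symmetry `s(y, x) = (1 - x, 1 - y)` preserves Lebesgue measure on the plane. [folklore] -/
theorem measurePreserving_symm :
    MeasurePreserving (fun p : ℝ × ℝ => (1 - p.2, 1 - p.1)) volume volume := by
  have hneg : MeasurePreserving (fun t : ℝ => (-1) * t) volume volume :=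
    ⟨measurable_const_mul _, by rw [Real.map_volume_mul_left (by norm_num)]; simp⟩
  have hr : MeasurePreserving (fun t : ℝ => 1 - t) volume volume := by
    have hfun : (fun t : ℝ => 1 - t) = (fun t : ℝ => 1 + t) ∘ (fun t : ℝ => (-1) * t) := by
      funext t
      simp only [Function.comp_apply]
      ring
    rw [hfun]
    exact (measurePreserving_add_left (volume : Measure ℝ) (1 : ℝ)).comp hneg
  have hfun2 : (fun p : ℝ × ℝ => (1 - p.2, 1 - p.1)) =
      Prod.map (fun t : ℝ => 1 - t) (fun t : ℝ => 1 - t) ∘ Prod.swap := by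
    funext p
    rfl
  rw [hfun2, Measure.volume_eq_prod]
  exact (hr.prod hr).comp Measure.measurePreserving_swap

/-- The symmetry preserves the triangle. [folklore] -/
theorem preimage_symm_triangle :
    (fun p : ℝ × ℝ => (1 - p.2, 1 - p.1)) ⁻¹' {p : ℝ × ℝ | 0 < p.2 ∧ p.2 < p.1 ∧ p.1 < 1} =
      {p : ℝ × ℝ | 0 < p.2 ∧ p.2 < p.1 ∧ p.1 < 1} := by
  ext p
  simp only [mem_preimage, mem_setOf_eq]
  constructor
  · rintro ⟨h1, h2, h3⟩; exact ⟨by linarith, by linarith, by linarith⟩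
  · rintro ⟨h1, h2, h3⟩; exact ⟨by linarith, by linarith, by linarith⟩

/-- Integrability on the triangle is invariant under the symmetry. [folklore] -/
theorem integrableOn_symm_iff {F : ℝ × ℝ → ℝ} :
    IntegrableOn (fun p : ℝ × ℝ => F (1 - p.2, 1 - p.1)) {p : ℝ × ℝ | 0 < p.2 ∧ p.2 < p.1 ∧ p.1 < 1}
        volume ↔
      IntegrableOn F {p : ℝ × ℝ | 0 < p.2 ∧ p.2 < p.1 ∧ p.1 < 1} volume := by
  have he : MeasurableEmbedding (fun p : ℝ × ℝ => (1 - p.2, 1 - p.1)) :=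
    (⟨⟨fun p => (1 - p.2, 1 - p.1), fun p => (1 - p.2, 1 - p.1), fun p => by simp,
        fun p => by simp⟩,
      (measurable_const.sub measurable_snd).prodMk (measurable_const.sub measurable_fst),
      (measurable_const.sub measurable_snd).prodMk (measurable_const.sub measurable_fst)⟩ :
        (ℝ × ℝ) ≃ᵐ (ℝ × ℝ)).measurableEmbedding
  have := measurePreserving_symm.integrableOn_comp_preimage he (f := F)
    (s := {p : ℝ × ℝ | 0 < p.2 ∧ p.2 < p.1 ∧ p.1 < 1})
  rw [preimage_symm_triangle] at this
  exact this

/-! ### Step 2: the edge `y = 1` (through the symmetry) -/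

/-- **Edge `y = 1`.** If `P(y,x)/(y^{b₀} (1-y)^{c₀} (1-x)^{c₁})` is integrable on the triangle,
then on the triangle it equals `D(y,x)/(y^{b₀} (1-x)^{c₁})` for some `D ∈ ℚ[y][x]` (apply Step 1
to the reflected data `(σP, c₁, c₀, 0, b₀, 0)` and reflect back). [Brown 2009, Lemma 7.4]
[folklore] -/
theorem exists_reduce_edge_one (P : ℚ[X][X]) (b₀ c₀ c₁ : ℕ)
    (h : IntegrableOn (fun p : ℝ × ℝ =>
        (P.map (eval₂RingHom (algebraMap ℚ ℝ) p.1)).eval p.2 /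
          (p.1 ^ b₀ * p.2 ^ 0 * (1 - p.1) ^ c₀ * (1 - p.2) ^ c₁ * (p.1 - p.2) ^ 0))
        {p : ℝ × ℝ | 0 < p.2 ∧ p.2 < p.1 ∧ p.1 < 1} volume) :
    ∃ D : ℚ[X][X], ∀ p ∈ ({p : ℝ × ℝ | 0 < p.2 ∧ p.2 < p.1 ∧ p.1 < 1} : Set (ℝ × ℝ)),
      (P.map (eval₂RingHom (algebraMap ℚ ℝ) p.1)).eval p.2 /
          (p.1 ^ b₀ * p.2 ^ 0 * (1 - p.1) ^ c₀ * (1 - p.2) ^ c₁ * (p.1 - p.2) ^ 0) =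
        (D.map (eval₂RingHom (algebraMap ℚ ℝ) p.1)).eval p.2 /
          (p.1 ^ b₀ * p.2 ^ 0 * (1 - p.1) ^ 0 * (1 - p.2) ^ c₁ * (p.1 - p.2) ^ 0) := by
  set σ : ℚ[X][X] →+* ℚ[X][X] := eval₂RingHom
    (eval₂RingHom ((C : ℚ[X] →+* ℚ[X][X]).comp (C : ℚ →+* ℚ[X])) (1 - X)) (C (1 - X)) with hσ
  -- integrability of the reflected data `(σP, c₁, c₀, 0, b₀, 0)`
  have h1 : IntegrableOn (fun p : ℝ × ℝ =>
      ((σ P).map (eval₂RingHom (algebraMap ℚ ℝ) p.1)).eval p.2 /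
        (p.1 ^ c₁ * p.2 ^ c₀ * (1 - p.1) ^ 0 * (1 - p.2) ^ b₀ * (p.1 - p.2) ^ 0))
      {p : ℝ × ℝ | 0 < p.2 ∧ p.2 < p.1 ∧ p.1 < 1} volume := by
    have h2 := (integrableOn_symm_iff (F := fun p : ℝ × ℝ =>
      (P.map (eval₂RingHom (algebraMap ℚ ℝ) p.1)).eval p.2 /
        (p.1 ^ b₀ * p.2 ^ 0 * (1 - p.1) ^ c₀ * (1 - p.2) ^ c₁ * (p.1 - p.2) ^ 0))).2 h
    refine h2.congr_fun (fun p _ => ?_) measurableSet_triangle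
    exact integrand_symm_apply P b₀ 0 c₀ c₁ 0 p
  obtain ⟨D₁, hD₁⟩ := exists_reduce_edges (σ P) c₁ c₀ 0 b₀ 0 h1
  refine ⟨σ D₁, fun p hp => ?_⟩
  have hq : ((1 : ℝ) - p.2, (1 : ℝ) - p.1) ∈
      ({p : ℝ × ℝ | 0 < p.2 ∧ p.2 < p.1 ∧ p.1 < 1} : Set (ℝ × ℝ)) := by
    have := preimage_symm_triangle.symm.subset hp
    exact this
  have e1 := integrand_symm_apply P b₀ 0 c₀ c₁ 0 (1 - p.2, 1 - p.1)
  have e2 := hD₁ (1 - p.2, 1 - p.1) hq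
  have e3 := integrand_symm_apply D₁ c₁ 0 0 b₀ 0 p
  simp only [sub_sub_cancel] at e1 e2 e3
  rw [e1, e2, e3]

/-! ### Values and scaled sections of `P ∈ ℚ[y][x]` -/

/-- The value `P(y, x)` as a finite sum over the `x`-coefficients. [folklore] -/
theorem eval_section_eq_sum (P : ℚ[X][X]) (y x : ℝ) :
    (P.map (eval₂RingHom (algebraMap ℚ ℝ) y)).eval x =
      ∑ j ∈ Finset.range (P.natDegree + 1), ((P.coeff j).map (algebraMap ℚ ℝ)).eval y * x ^ j := by
  rw [eval_map, eval₂_eq_sum_range]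
  refine Finset.sum_congr rfl fun j _ => ?_
  rw [coe_eval₂RingHom, eval_map]

/-- `(y, x) ↦ P(y, x)` is continuous. [folklore] -/
theorem continuous_eval_section (P : ℚ[X][X]) :
    Continuous fun p : ℝ × ℝ => (P.map (eval₂RingHom (algebraMap ℚ ℝ) p.1)).eval p.2 := by
  have : (fun p : ℝ × ℝ => (P.map (eval₂RingHom (algebraMap ℚ ℝ) p.1)).eval p.2) =
      fun p => ∑ j ∈ Finset.range (P.natDegree + 1),
        ((P.coeff j).map (algebraMap ℚ ℝ)).eval p.1 * p.2 ^ j :=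
    funext fun p => eval_section_eq_sum P p.1 p.2
  rw [this]
  refine continuous_finsetSum _ fun j _ => ?_
  exact ((Polynomial.continuous _).comp continuous_fst).mul ((continuous_pow j).comp continuous_snd)

/-- **Scaled sections.** Along the ray `x = u y` the value `P(y, u y)` is the real polynomial
`Π_u = P.eval₂ (map) (C u · X)` in `y`, evaluated at `y`. [folklore] -/
theorem eval_section_scaled (P : ℚ[X][X]) (u y : ℝ) :
    (P.map (eval₂RingHom (algebraMap ℚ ℝ) y)).eval (y * u) =
      (P.eval₂ (mapRingHom (algebraMap ℚ ℝ)) (C u * X)).eval y := by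
  have hcomp : (evalRingHom y).comp (mapRingHom (algebraMap ℚ ℝ)) = eval₂RingHom (algebraMap ℚ ℝ) y := by
    refine Polynomial.ringHom_ext (fun c => ?_) ?_
    · simp
    · simp
  rw [eval_map, ← coe_evalRingHom, hom_eval₂, hcomp]
  congr 1
  rw [coe_evalRingHom, eval_mul, eval_C, eval_X, mul_comm]

/-- Coefficients of the scaled section: `(Π_u)_m = Θ_m(u)` with
`Θ_m = ∑_{j ≤ m} c_{m-j, j} uʲ ∈ ℚ[u]`, `c_{ij}` the coefficient of `yⁱ xʲ` in `P`. [folklore] -/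
theorem coeff_section_scaled (P : ℚ[X][X]) (u : ℝ) (m : ℕ) :
    (P.eval₂ (mapRingHom (algebraMap ℚ ℝ)) (C u * X)).coeff m =
      aeval u (∑ j ∈ Finset.range (P.natDegree + 1),
        C (if j ≤ m then (P.coeff j).coeff (m - j) else 0) * X ^ j) := by
  rw [eval₂_eq_sum_range, finsetSum_coeff, map_sum]
  refine Finset.sum_congr rfl fun j _ => ?_
  rw [mul_pow, ← C_pow, ← mul_assoc, coeff_mul_X_pow', coeff_mul_C, coe_mapRingHom, coeff_map,
    map_mul, aeval_C, map_pow, aeval_X]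
  split_ifs with hj
  · rfl
  · simp

/-- Coefficients of `Θ_m`: for `j₀ ≤ P.natDegree`, `(Θ_m)_{j₀} = c_{m-j₀, j₀}` if `j₀ ≤ m`. [folklore] -/
theorem coeff_theta (P : ℚ[X][X]) (m j₀ : ℕ) (hj₀ : j₀ < P.natDegree + 1) (hjm : j₀ ≤ m) :
    (∑ j ∈ Finset.range (P.natDegree + 1),
        C (if j ≤ m then (P.coeff j).coeff (m - j) else 0) * X ^ j : ℚ[X]).coeff j₀ =
      (P.coeff j₀).coeff (m - j₀) := by
  rw [finsetSum_coeff]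
  simp only [coeff_C_mul_X_pow]
  rw [Finset.sum_ite_eq (Finset.range (P.natDegree + 1)) j₀, if_pos (Finset.mem_range.2 hj₀),
    if_pos hjm]

/-! ### Tonelli on the triangle and the square; scaling of the inner variable -/

/-- Tonelli on the triangle: `∫⁻_T g = ∫⁻_{y∈(0,1)} ∫⁻_{x∈(0,y)} g(y,x)`. [folklore] -/
theorem lintegral_triangle {g : ℝ × ℝ → ℝ≥0∞} (hg : Measurable g) :
    ∫⁻ p in {p : ℝ × ℝ | 0 < p.2 ∧ p.2 < p.1 ∧ p.1 < 1}, g p =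
      ∫⁻ y in Ioo (0 : ℝ) 1, ∫⁻ x in Ioo 0 y, g (y, x) := by
  rw [← lintegral_indicator measurableSet_triangle, Measure.volume_eq_prod,
    lintegral_prod _ ((hg.indicator measurableSet_triangle).aemeasurable),
    ← lintegral_indicator measurableSet_Ioo]
  refine lintegral_congr fun y => ?_
  by_cases hy : y ∈ Ioo (0 : ℝ) 1
  · rw [indicator_of_mem hy, ← lintegral_indicator measurableSet_Ioo]
    refine lintegral_congr fun x => ?_
    by_cases hx : x ∈ Ioo 0 y
    · rw [indicator_of_mem hx, indicator_of_mem (show (y, x) ∈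
        ({p : ℝ × ℝ | 0 < p.2 ∧ p.2 < p.1 ∧ p.1 < 1} : Set (ℝ × ℝ)) from ⟨hx.1, hx.2, hy.2⟩)]
    · rw [indicator_of_notMem hx, indicator_of_notMem]
      exact fun hm => hx ⟨hm.1, hm.2.1⟩
  · rw [indicator_of_notMem hy]
    refine (lintegral_congr fun x => ?_).trans lintegral_zero
    exact indicator_of_notMem (fun hm => hy ⟨hm.1.trans hm.2.1, hm.2.2⟩) _

/-- Tonelli on the unit square. [folklore] -/
theorem lintegral_square {g : ℝ × ℝ → ℝ≥0∞} (hg : Measurable g) :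
    ∫⁻ p in Ioo (0 : ℝ) 1 ×ˢ Ioo (0 : ℝ) 1, g p =
      ∫⁻ y in Ioo (0 : ℝ) 1, ∫⁻ u in Ioo (0 : ℝ) 1, g (y, u) := by
  rw [Measure.volume_eq_prod, ← Measure.prod_restrict, lintegral_prod _ hg.aemeasurable]

/-- Scaling the inner variable: `∫⁻_{(0,y)} g = y ∫⁻_{(0,1)} g(y·)` for `y > 0`. [folklore] -/
theorem lintegral_Ioo_scale {g : ℝ → ℝ≥0∞} (hg : Measurable g) {y : ℝ} (hy : 0 < y) :
    ∫⁻ x in Ioo 0 y, g x = ENNReal.ofReal y * ∫⁻ u in Ioo (0 : ℝ) 1, g (y * u) := by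
  have h1 : ∫⁻ u in Ioo (0 : ℝ) 1, g (y * u) = ∫⁻ u, (Ioo 0 y).indicator g (y * u) := by
    rw [← lintegral_indicator measurableSet_Ioo]
    refine lintegral_congr fun u => ?_
    by_cases hu : u ∈ Ioo (0 : ℝ) 1
    · rw [indicator_of_mem hu, indicator_of_mem]
      exact ⟨mul_pos hy hu.1, by nlinarith [hu.2]⟩
    · rw [indicator_of_notMem hu, indicator_of_notMem]
      rintro ⟨h0, h1⟩
      exact hu ⟨(mul_pos_iff_of_pos_left hy).1 h0, (mul_lt_iff_lt_one_right hy).1 h1⟩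
  have h2 : ∫⁻ u, (Ioo 0 y).indicator g (y * u) =
      ∫⁻ x, (Ioo 0 y).indicator g x ∂(Measure.map (fun u => y * u) volume) :=
    (lintegral_map (hg.indicator measurableSet_Ioo) (measurable_const_mul y)).symm
  rw [h1, h2, Real.map_volume_mul_left hy.ne', lintegral_smul_measure, smul_eq_mul,
    lintegral_indicator measurableSet_Ioo, ← mul_assoc, ← ENNReal.ofReal_mul hy.le,
    abs_of_pos (inv_pos.2 hy), mul_inv_cancel₀ hy.ne', ENNReal.ofReal_one, one_mul]

/-! ### Step 3: the corner `(0, 0)` (blow-up `x = u y`) -/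

/-- **Corner `(0,0)`.** If `P(y,x)/(y^{b₀} (1-x)^{c₁})` is integrable on the triangle then
`P` vanishes at `(0,0)` to order at least `b₀ - 1`: every coefficient `c_{ij}` of `yⁱ xʲ` with
`i + j + 1 < b₀` is zero. Proof: by Tonelli and the scaling `x = u y`, the function
`(y, u) ↦ y P(y, uy)/(y^{b₀} (1-uy)^{c₁})` is integrable on the unit square, hence for almost
every `u` its `y`-section `Π_u(y)/(y^{b₀-1} (1-uy)^{c₁})` is integrable on `(0,1)`, which by the
1-D pole lemma forces `y^{b₀-1} ∣ Π_u`; the low coefficients `Θ_m(u)` of `Π_u` thus vanish for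
infinitely many `u`, i.e. identically. (The blow-up of the corner of the cell in `𝔐̄_{0,5}`.)
[Brown 2009, Lemma 7.4 / Lemma 4.9] [folklore] -/
theorem coeff_eq_zero_of_corner (P : ℚ[X][X]) (b₀ c₁ : ℕ)
    (h : IntegrableOn (fun p : ℝ × ℝ =>
        (P.map (eval₂RingHom (algebraMap ℚ ℝ) p.1)).eval p.2 /
          (p.1 ^ b₀ * p.2 ^ 0 * (1 - p.1) ^ 0 * (1 - p.2) ^ c₁ * (p.1 - p.2) ^ 0))
        {p : ℝ × ℝ | 0 < p.2 ∧ p.2 < p.1 ∧ p.1 < 1} volume)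
    {i j : ℕ} (hij : i + j + 1 < b₀) : (P.coeff j).coeff i = 0 := by
  obtain ⟨B, rfl⟩ : ∃ B, b₀ = B + 1 := ⟨b₀ - 1, by omega⟩
  -- the integrand and its measurability
  set F : ℝ × ℝ → ℝ := fun p => (P.map (eval₂RingHom (algebraMap ℚ ℝ) p.1)).eval p.2 /
    (p.1 ^ (B + 1) * p.2 ^ 0 * (1 - p.1) ^ 0 * (1 - p.2) ^ c₁ * (p.1 - p.2) ^ 0) with hF
  have hFm : Measurable F := (continuous_eval_section P).measurable.div (by fun_prop)
  have hGm : Measurable fun p : ℝ × ℝ => p.1 * F (p.1, p.1 * p.2) :=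
    measurable_fst.mul (hFm.comp (measurable_fst.prodMk (measurable_fst.mul measurable_snd)))
  -- `G(y, u) = y F(y, uy)` is integrable on the unit square
  have hG : IntegrableOn (fun p : ℝ × ℝ => p.1 * F (p.1, p.1 * p.2)) (Ioo (0 : ℝ) 1 ×ˢ Ioo (0 : ℝ) 1)
      volume := by
    refine ⟨hGm.aestronglyMeasurable, ?_⟩
    rw [hasFiniteIntegral_def]
    calc ∫⁻ p in Ioo (0 : ℝ) 1 ×ˢ Ioo (0 : ℝ) 1, ‖p.1 * F (p.1, p.1 * p.2)‖ₑ
        = ∫⁻ y in Ioo (0 : ℝ) 1, ∫⁻ u in Ioo (0 : ℝ) 1, ‖y * F (y, y * u)‖ₑ :=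
          lintegral_square hGm.enorm
      _ = ∫⁻ y in Ioo (0 : ℝ) 1, ∫⁻ x in Ioo 0 y, ‖F (y, x)‖ₑ := by
          refine setLIntegral_congr_fun measurableSet_Ioo fun y hy => ?_
          have hm1 : Measurable fun x : ℝ => ‖F (y, x)‖ₑ :=
            (hFm.comp (measurable_const.prodMk measurable_id)).enorm
          have hm2 : Measurable fun u : ℝ => ‖F (y, y * u)‖ₑ :=
            (hFm.comp (measurable_const.prodMk (measurable_const.mul measurable_id))).enorm
          rw [lintegral_Ioo_scale hm1 hy.1, ← lintegral_const_mul _ hm2]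
          refine lintegral_congr fun u => ?_
          rw [enorm_mul, Real.enorm_eq_ofReal hy.1.le]
      _ = ∫⁻ p in {p : ℝ × ℝ | 0 < p.2 ∧ p.2 < p.1 ∧ p.1 < 1}, ‖F p‖ₑ :=
          (lintegral_triangle hFm.enorm).symm
      _ < ∞ := h.2
  have hG' : Integrable (fun p : ℝ × ℝ => p.1 * F (p.1, p.1 * p.2))
      ((volume.restrict (Ioo (0 : ℝ) 1)).prod (volume.restrict (Ioo (0 : ℝ) 1))) := by
    rw [Measure.prod_restrict, ← Measure.volume_eq_prod]
    exact hG
  -- for a.e. `u`, the low coefficients of the scaled section vanish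
  have hdiv : ∀ᵐ u ∂(volume.restrict (Ioo (0 : ℝ) 1)), ∀ m < B,
      (P.eval₂ (mapRingHom (algebraMap ℚ ℝ)) (C u * X)).coeff m = 0 := by
    filter_upwards [ae_restrict_mem measurableSet_Ioo, hG'.prod_left_ae] with u hu hu'
    have hX : (X - C (0 : ℝ)) ^ B ∣ P.eval₂ (mapRingHom (algebraMap ℚ ℝ)) (C u * X) := by
      refine X_sub_C_pow_dvd_of_integrableOn_unit (k := B) (x₀ := 0) (u := 0) (v := 1) one_pos
        left_mem_uIcc (ψ := fun y => (1 - y * u) ^ c₁) (by fun_prop) (by simp) ?_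
      have hI : IntegrableOn (fun y : ℝ => y * F (y, y * u)) (Ioo (0 : ℝ) 1) volume := hu'
      refine hI.congr_fun (fun y hy => ?_) measurableSet_Ioo
      have hy0 : y ≠ 0 := hy.1.ne'
      have hyu : (1 - y * u) ≠ 0 := by
        have : y * u < 1 := by nlinarith [hy.1, hy.2, hu.1, hu.2]
        linarith
      simp only [hF, pow_zero, mul_one, sub_zero]
      rw [eval_section_scaled]
      field_simp
      ring
    intro m hm
    rw [map_zero, sub_zero, X_pow_dvd_iff] at hX
    exact hX m hm
  -- `Θ_m` vanishes identically for `m = i + j < B`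
  have hmB : i + j < B := by omega
  have hΘ : (∑ j' ∈ Finset.range (P.natDegree + 1),
      C (if j' ≤ i + j then (P.coeff j').coeff (i + j - j') else 0) * X ^ j' : ℚ[X]) = 0 := by
    have hroots : Set.Infinite {u : ℝ | IsRoot ((∑ j' ∈ Finset.range (P.natDegree + 1),
        C (if j' ≤ i + j then (P.coeff j').coeff (i + j - j') else 0) * X ^ j' : ℚ[X]).map
          (algebraMap ℚ ℝ)) u} := by
      refine infinite_of_ae_Ioo (hdiv.mono fun u hu => ?_)
      rw [IsRoot.def, eval_map, ← aeval_def, ← coeff_section_scaled]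
      exact hu (i + j) hmB
    have hz := eq_zero_of_infinite_isRoot _ hroots
    rwa [Polynomial.map_eq_zero_iff (algebraMap ℚ ℝ).injective] at hz
  by_cases hjN : j < P.natDegree + 1
  · have := coeff_theta P (i + j) j hjN (by omega)
    rw [hΘ, coeff_zero, Nat.add_sub_cancel] at this
    exact this.symm
  · have : P.coeff j = 0 := coeff_eq_zero_of_natDegree_lt (by omega)
    rw [this, coeff_zero]

/-- **Corner `(1,1)`** (through the symmetry): if `P(y,x)/(y^{b₀} (1-x)^{c₁})` is integrable on
the triangle then `σP` vanishes at `(0,0)` to order at least `c₁ - 1`, i.e. `P` vanishes at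
`(1,1)` to that order. [Brown 2009, Lemma 7.4] [folklore] -/
theorem coeff_sigma_eq_zero_of_corner (P : ℚ[X][X]) (b₀ c₁ : ℕ)
    (h : IntegrableOn (fun p : ℝ × ℝ =>
        (P.map (eval₂RingHom (algebraMap ℚ ℝ) p.1)).eval p.2 /
          (p.1 ^ b₀ * p.2 ^ 0 * (1 - p.1) ^ 0 * (1 - p.2) ^ c₁ * (p.1 - p.2) ^ 0))
        {p : ℝ × ℝ | 0 < p.2 ∧ p.2 < p.1 ∧ p.1 < 1} volume)
    {i j : ℕ} (hij : i + j + 1 < c₁) :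
    (((eval₂RingHom (eval₂RingHom ((C : ℚ[X] →+* ℚ[X][X]).comp (C : ℚ →+* ℚ[X])) (1 - X))
        (C (1 - X))) P).coeff j).coeff i = 0 := by
  have h1 : IntegrableOn (fun p : ℝ × ℝ =>
      (((eval₂RingHom (eval₂RingHom ((C : ℚ[X] →+* ℚ[X][X]).comp (C : ℚ →+* ℚ[X])) (1 - X))
        (C (1 - X))) P).map (eval₂RingHom (algebraMap ℚ ℝ) p.1)).eval p.2 /
        (p.1 ^ c₁ * p.2 ^ 0 * (1 - p.1) ^ 0 * (1 - p.2) ^ b₀ * (p.1 - p.2) ^ 0))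
      {p : ℝ × ℝ | 0 < p.2 ∧ p.2 < p.1 ∧ p.1 < 1} volume := by
    have h2 := (integrableOn_symm_iff (F := fun p : ℝ × ℝ =>
      (P.map (eval₂RingHom (algebraMap ℚ ℝ) p.1)).eval p.2 /
        (p.1 ^ b₀ * p.2 ^ 0 * (1 - p.1) ^ 0 * (1 - p.2) ^ c₁ * (p.1 - p.2) ^ 0))).2 h
    refine h2.congr_fun (fun p _ => ?_) measurableSet_triangle
    exact integrand_symm_apply P b₀ 0 0 c₁ 0 p
  exact coeff_eq_zero_of_corner _ c₁ b₀ h1 hij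

/-! ### Step 4: spanning by dihedral monomials

With `B = b₀ - 1`, `C = c₁ - 1` and a Bézout identity `A(x) x^B + A'(x) (1-x)^C = 1` in `ℚ[x]`,
the two vanishing orders write `P/(y^{b₀} (1-x)^{c₁})` as a finite rational combination of the
monomials `xⁱ y^J (1-x)^K (1-y)^l` of `GenusZeroPeriodsMZVDimTwoSeriesProofs` (all with
`i + J ≥ -1`, `K + l ≥ -1`). -/

/-- Finite sums of functions with integrals in `∑_{w ≤ 2} 𝒵_w`. [folklore] -/
theorem integrableOn_sum_and_mem {ι : Type*} (s : Finset ι) (f : ι → ℝ × ℝ → ℝ)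
    (hf : ∀ k ∈ s, IntegrableOn (f k) {p : ℝ × ℝ | 0 < p.2 ∧ p.2 < p.1 ∧ p.1 < 1} volume ∧
      (∫ p in {p : ℝ × ℝ | 0 < p.2 ∧ p.2 < p.1 ∧ p.1 < 1}, f k p) ∈
        ⨆ (w : ℕ) (_ : w ≤ 2), mzvSpace w) :
    IntegrableOn (fun p => ∑ k ∈ s, f k p) {p : ℝ × ℝ | 0 < p.2 ∧ p.2 < p.1 ∧ p.1 < 1} volume ∧
      (∫ p in {p : ℝ × ℝ | 0 < p.2 ∧ p.2 < p.1 ∧ p.1 < 1}, ∑ k ∈ s, f k p) ∈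
        ⨆ (w : ℕ) (_ : w ≤ 2), mzvSpace w := by
  refine ⟨integrable_finsetSum s fun k hk => (hf k hk).1, ?_⟩
  rw [integral_finsetSum s fun k hk => (hf k hk).1]
  exact Submodule.sum_mem _ fun k hk => (hf k hk).2

/-- A rational multiple of a function with integral in `∑_{w ≤ 2} 𝒵_w`, the multiple being
zero whenever the function might fail to be integrable. [folklore] -/
theorem integrableOn_smul_and_mem (q : ℚ) (g : ℝ × ℝ → ℝ)
    (hg : q ≠ 0 → IntegrableOn g {p : ℝ × ℝ | 0 < p.2 ∧ p.2 < p.1 ∧ p.1 < 1} volume ∧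
      (∫ p in {p : ℝ × ℝ | 0 < p.2 ∧ p.2 < p.1 ∧ p.1 < 1}, g p) ∈
        ⨆ (w : ℕ) (_ : w ≤ 2), mzvSpace w) :
    IntegrableOn (fun p => (q : ℝ) * g p) {p : ℝ × ℝ | 0 < p.2 ∧ p.2 < p.1 ∧ p.1 < 1} volume ∧
      (∫ p in {p : ℝ × ℝ | 0 < p.2 ∧ p.2 < p.1 ∧ p.1 < 1}, (q : ℝ) * g p) ∈
        ⨆ (w : ℕ) (_ : w ≤ 2), mzvSpace w := by
  by_cases hq : q = 0
  · subst hq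
    simp only [Rat.cast_zero, zero_mul, integral_zero]
    exact ⟨integrableOn_zero, zero_mem _⟩
  · obtain ⟨h1, h2⟩ := hg hq
    refine ⟨h1.const_mul _, ?_⟩
    rw [integral_const_mul]
    exact ratCast_mul_mem_iSup_mzvSpace q h2

/-- The value `P(y,x)` as a double sum `∑ⱼ ∑ᵢ c_{ij} yⁱ xʲ`. [folklore] -/
theorem eval_section_eq_sum_sum (P : ℚ[X][X]) (y x : ℝ) :
    (P.map (eval₂RingHom (algebraMap ℚ ℝ) y)).eval x =
      ∑ j ∈ Finset.range (P.natDegree + 1), ∑ i ∈ Finset.range ((P.coeff j).natDegree + 1),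
        (((P.coeff j).coeff i : ℚ) : ℝ) * y ^ i * x ^ j := by
  rw [eval_section_eq_sum]
  refine Finset.sum_congr rfl fun j _ => ?_
  rw [eval_map, eval₂_eq_sum_range, Finset.sum_mul]
  refine Finset.sum_congr rfl fun i _ => ?_
  rw [eq_ratCast]

/-- First family of terms (from the order at `(1,1)` and the summand `A x^B` of Bézout):
`(1-x)ⁱ (1-y)ʲ · xᵐ · x^B / (y^{b₀} (1-x)^{c₁}) = x^{B+m} y^{-b₀} (1-x)^{i-c₁} (1-y)ʲ`. [folklore] -/
theorem term₁_eq {x y : ℝ} (hy : y ≠ 0) (hx : 1 - x ≠ 0) (e a : ℝ) (i j m B b₀ c₁ : ℕ) :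
    e * (1 - x) ^ i * (1 - y) ^ j * (a * x ^ m) * x ^ B / (y ^ b₀ * (1 - x) ^ c₁) =
      (e * a) * (x ^ (B + m) * y ^ (-(b₀ : ℤ)) * (1 - x) ^ ((i : ℤ) - c₁) * (1 - y) ^ j) := by
  rw [zpow_neg, zpow_natCast, zpow_sub₀ hx, zpow_natCast, zpow_natCast, pow_add]
  field_simp

/-- Second family of terms (from the order at `(0,0)` and the summand `A' (1-x)^C`):
`yⁱ xʲ · xᵐ · (1-x)^C / (y^{b₀} (1-x)^{c₁}) = x^{j+m} y^{i-b₀} (1-x)^{C-c₁} (1-y)⁰`. [folklore] -/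
theorem term₂_eq {x y : ℝ} (hy : y ≠ 0) (hx : 1 - x ≠ 0) (c a : ℝ) (i j m Cc b₀ c₁ : ℕ) :
    c * y ^ i * x ^ j * (a * x ^ m) * (1 - x) ^ Cc / (y ^ b₀ * (1 - x) ^ c₁) =
      (c * a) * (x ^ (j + m) * y ^ ((i : ℤ) - b₀) * (1 - x) ^ ((Cc : ℤ) - c₁) * (1 - y) ^ 0) := by
  rw [zpow_sub₀ hy, zpow_natCast, zpow_natCast, zpow_sub₀ hx, zpow_natCast, zpow_natCast,
    pow_add, pow_zero, mul_one]
  field_simp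

/-- **Spanning by dihedral monomials, and the value.** If `P` vanishes at `(0,0)` to order
`≥ b₀ - 1` and at `(1,1)` to order `≥ c₁ - 1` (the two corner conditions), then
`∫_T P(y,x)/(y^{b₀} (1-x)^{c₁}) ∈ ℚ + ℚ ζ(2)`: by Bézout the integrand is a finite rational
combination of the convergent monomials of `integral_monomial_mem`. [Brown 2009, Lemma 7.4 and
Thm 8.2 (|S| = 5)] [folklore] -/
theorem integral_mem_of_orders (P : ℚ[X][X]) (b₀ c₁ : ℕ)
    (hc : ∀ i j : ℕ, i + j + 1 < b₀ → (P.coeff j).coeff i = 0)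
    (he : ∀ i j : ℕ, i + j + 1 < c₁ →
      (((eval₂RingHom (eval₂RingHom ((C : ℚ[X] →+* ℚ[X][X]).comp (C : ℚ →+* ℚ[X])) (1 - X))
        (C (1 - X))) P).coeff j).coeff i = 0) :
    (∫ p in {p : ℝ × ℝ | 0 < p.2 ∧ p.2 < p.1 ∧ p.1 < 1},
        (P.map (eval₂RingHom (algebraMap ℚ ℝ) p.1)).eval p.2 /
          (p.1 ^ b₀ * p.2 ^ 0 * (1 - p.1) ^ 0 * (1 - p.2) ^ c₁ * (p.1 - p.2) ^ 0)) ∈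
      ⨆ (w : ℕ) (_ : w ≤ 2), mzvSpace w := by
  set σP := (eval₂RingHom (eval₂RingHom ((C : ℚ[X] →+* ℚ[X][X]).comp (C : ℚ →+* ℚ[X])) (1 - X))
    (C (1 - X))) P with hσP
  -- Bézout in `ℚ[x]`
  obtain ⟨A, A', hAA'⟩ : IsCoprime ((X : ℚ[X]) ^ (b₀ - 1)) ((1 - X) ^ (c₁ - 1)) :=
    (show IsCoprime (X : ℚ[X]) (1 - X) from ⟨1, 1, by ring⟩).pow
  -- the two families of terms
  set t₁ : ℕ → ℕ → ℕ → ℝ × ℝ → ℝ := fun j i m p =>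
    (((σP.coeff j).coeff i * A.coeff m : ℚ) : ℝ) *
      (p.2 ^ (b₀ - 1 + m) * p.1 ^ (-(b₀ : ℤ)) * (1 - p.2) ^ ((i : ℤ) - c₁) * (1 - p.1) ^ j) with ht₁
  set t₂ : ℕ → ℕ → ℕ → ℝ × ℝ → ℝ := fun j i m p =>
    (((P.coeff j).coeff i * A'.coeff m : ℚ) : ℝ) *
      (p.2 ^ (j + m) * p.1 ^ ((i : ℤ) - b₀) * (1 - p.2) ^ (((c₁ - 1 : ℕ) : ℤ) - c₁) * (1 - p.1) ^ 0)
    with ht₂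
  -- each term is integrable with integral in `ℚ + ℚ ζ(2)`
  have h₁ : ∀ j i m, IntegrableOn (t₁ j i m) {p : ℝ × ℝ | 0 < p.2 ∧ p.2 < p.1 ∧ p.1 < 1} volume ∧
      (∫ p in {p : ℝ × ℝ | 0 < p.2 ∧ p.2 < p.1 ∧ p.1 < 1}, t₁ j i m p) ∈
        ⨆ (w : ℕ) (_ : w ≤ 2), mzvSpace w := by
    intro j i m
    refine integrableOn_smul_and_mem _ _ fun hq => ?_
    have hij : c₁ ≤ i + j + 1 := by
      by_contra hlt
      exact hq (by rw [he i j (by omega), zero_mul])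
    exact integral_monomial_mem (b₀ - 1 + m) j (-(b₀ : ℤ)) ((i : ℤ) - c₁) (by omega) (by omega)
  have h₂ : ∀ j i m, IntegrableOn (t₂ j i m) {p : ℝ × ℝ | 0 < p.2 ∧ p.2 < p.1 ∧ p.1 < 1} volume ∧
      (∫ p in {p : ℝ × ℝ | 0 < p.2 ∧ p.2 < p.1 ∧ p.1 < 1}, t₂ j i m p) ∈
        ⨆ (w : ℕ) (_ : w ≤ 2), mzvSpace w := by
    intro j i m
    refine integrableOn_smul_and_mem _ _ fun hq => ?_
    have hij : b₀ ≤ i + j + 1 := by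
      by_contra hlt
      exact hq (by rw [hc i j (by omega), zero_mul])
    exact integral_monomial_mem (j + m) 0 ((i : ℤ) - b₀) (((c₁ - 1 : ℕ) : ℤ) - c₁) (by omega)
      (by omega)
  -- the sums
  have hS₁ := integrableOn_sum_and_mem (Finset.range (σP.natDegree + 1)) _ fun j _ =>
    integrableOn_sum_and_mem (Finset.range ((σP.coeff j).natDegree + 1)) _ fun i _ =>
      integrableOn_sum_and_mem (Finset.range (A.natDegree + 1)) _ fun m _ => h₁ j i m
  have hS₂ := integrableOn_sum_and_mem (Finset.range (P.natDegree + 1)) _ fun j _ =>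
    integrableOn_sum_and_mem (Finset.range ((P.coeff j).natDegree + 1)) _ fun i _ =>
      integrableOn_sum_and_mem (Finset.range (A'.natDegree + 1)) _ fun m _ => h₂ j i m
  -- the pointwise identity on the triangle
  have hpt : EqOn (fun p : ℝ × ℝ => (P.map (eval₂RingHom (algebraMap ℚ ℝ) p.1)).eval p.2 /
        (p.1 ^ b₀ * p.2 ^ 0 * (1 - p.1) ^ 0 * (1 - p.2) ^ c₁ * (p.1 - p.2) ^ 0))
      (fun p => (∑ j ∈ Finset.range (σP.natDegree + 1),
          ∑ i ∈ Finset.range ((σP.coeff j).natDegree + 1),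
            ∑ m ∈ Finset.range (A.natDegree + 1), t₁ j i m p) +
        (∑ j ∈ Finset.range (P.natDegree + 1),
          ∑ i ∈ Finset.range ((P.coeff j).natDegree + 1),
            ∑ m ∈ Finset.range (A'.natDegree + 1), t₂ j i m p))
      {p : ℝ × ℝ | 0 < p.2 ∧ p.2 < p.1 ∧ p.1 < 1} := by
    intro p hp
    have hy : p.1 ≠ 0 := (hp.1.trans hp.2.1).ne'
    have hx : 1 - p.2 ≠ 0 := sub_ne_zero.2 (hp.2.1.trans hp.2.2).ne'
    -- Bézout evaluated at `x`
    have hbez : (1 : ℝ) = aeval p.2 A * p.2 ^ (b₀ - 1) + aeval p.2 A' * (1 - p.2) ^ (c₁ - 1) := by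
      have := congrArg (aeval p.2) hAA'
      simpa using this.symm
    have hA : aeval p.2 A = ∑ m ∈ Finset.range (A.natDegree + 1), ((A.coeff m : ℚ) : ℝ) * p.2 ^ m := by
      rw [aeval_def, eval₂_eq_sum_range]
      simp only [eq_ratCast]
    have hA' : aeval p.2 A' =
        ∑ m ∈ Finset.range (A'.natDegree + 1), ((A'.coeff m : ℚ) : ℝ) * p.2 ^ m := by
      rw [aeval_def, eval₂_eq_sum_range]
      simp only [eq_ratCast]
    -- the two expansions of `P(y, x)`
    have hP₂ := eval_section_eq_sum_sum P p.1 p.2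
    have hP₁ : (P.map (eval₂RingHom (algebraMap ℚ ℝ) p.1)).eval p.2 =
        ∑ j ∈ Finset.range (σP.natDegree + 1), ∑ i ∈ Finset.range ((σP.coeff j).natDegree + 1),
          (((σP.coeff j).coeff i : ℚ) : ℝ) * (1 - p.2) ^ i * (1 - p.1) ^ j := by
      have := section_sigma σP p.1 p.2
      rw [hσP, sigma_sigma] at this
      rw [← hσP] at this
      rw [this, eval_section_eq_sum_sum]
    simp only
    rw [pow_zero, pow_zero, pow_zero, mul_one, mul_one, mul_one]
    calc (P.map (eval₂RingHom (algebraMap ℚ ℝ) p.1)).eval p.2 / (p.1 ^ b₀ * (1 - p.2) ^ c₁)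
        = ((P.map (eval₂RingHom (algebraMap ℚ ℝ) p.1)).eval p.2 * (aeval p.2 A) * p.2 ^ (b₀ - 1))
              / (p.1 ^ b₀ * (1 - p.2) ^ c₁) +
            ((P.map (eval₂RingHom (algebraMap ℚ ℝ) p.1)).eval p.2 * (aeval p.2 A') *
              (1 - p.2) ^ (c₁ - 1)) / (p.1 ^ b₀ * (1 - p.2) ^ c₁) := by
          rw [← add_div]
          congr 1
          linear_combination (P.map (eval₂RingHom (algebraMap ℚ ℝ) p.1)).eval p.2 * hbez
      _ = _ := by
          congr 1
          · rw [hP₁, hA, Finset.sum_mul, Finset.sum_mul, Finset.sum_div]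
            refine Finset.sum_congr rfl fun j _ => ?_
            rw [Finset.sum_mul, Finset.sum_mul, Finset.sum_div]
            refine Finset.sum_congr rfl fun i _ => ?_
            rw [Finset.mul_sum, Finset.sum_mul, Finset.sum_div]
            refine Finset.sum_congr rfl fun m _ => ?_
            rw [ht₁]
            simp only
            push_cast
            exact term₁_eq hy hx _ _ i j m (b₀ - 1) b₀ c₁
          · rw [hP₂, hA', Finset.sum_mul, Finset.sum_mul, Finset.sum_div]
            refine Finset.sum_congr rfl fun j _ => ?_
            rw [Finset.sum_mul, Finset.sum_mul, Finset.sum_div]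
            refine Finset.sum_congr rfl fun i _ => ?_
            rw [Finset.mul_sum, Finset.sum_mul, Finset.sum_div]
            refine Finset.sum_congr rfl fun m _ => ?_
            rw [ht₂]
            simp only
            push_cast
            exact term₂_eq hy hx _ _ i j m (c₁ - 1) b₀ c₁
  rw [setIntegral_congr_fun measurableSet_triangle hpt, integral_add hS₁.1 hS₂.1]
  exact add_mem hS₁.2 hS₂.2

/-! ### Brown's theorem for `𝔐_{0,5}` -/

/-- **The structure theorem and the value, on the triangle.** If
`P(y,x)/(y^{b₀} x^{b₁} (1-y)^{c₀} (1-x)^{c₁} (y-x)^a)`, `P ∈ ℚ[y][x]`, is absolutely integrable on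
`{0 < x < y < 1}`, then its integral lies in `ℚ + ℚ ζ(2) = ∑_{w ≤ 2} 𝒵_w`: the edge conditions
(Steps 1–2) reduce to `b₁ = c₀ = a = 0`, the corner conditions (Step 3) and Bézout (Step 4) write
the integrand as a rational combination of convergent dihedral monomials, whose integrals are in
`ℚ + ℚ ζ(2)` (`integral_monomial_mem`). [Brown 2009, Lemma 7.4, Thm 8.2, Cor 8.3 for |S| = 5]
[cite: BrownENS2009, Thm 1.1 and Cor 8.3] -/
theorem integral_mem_of_integrableOn (P : ℚ[X][X]) (b₀ b₁ c₀ c₁ a : ℕ)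
    (h : IntegrableOn (fun p : ℝ × ℝ =>
        (P.map (eval₂RingHom (algebraMap ℚ ℝ) p.1)).eval p.2 /
          (p.1 ^ b₀ * p.2 ^ b₁ * (1 - p.1) ^ c₀ * (1 - p.2) ^ c₁ * (p.1 - p.2) ^ a))
        {p : ℝ × ℝ | 0 < p.2 ∧ p.2 < p.1 ∧ p.1 < 1} volume) :
    (∫ p in {p : ℝ × ℝ | 0 < p.2 ∧ p.2 < p.1 ∧ p.1 < 1},
        (P.map (eval₂RingHom (algebraMap ℚ ℝ) p.1)).eval p.2 /
          (p.1 ^ b₀ * p.2 ^ b₁ * (1 - p.1) ^ c₀ * (1 - p.2) ^ c₁ * (p.1 - p.2) ^ a)) ∈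
      ⨆ (w : ℕ) (_ : w ≤ 2), mzvSpace w := by
  obtain ⟨D₁, hD₁⟩ := exists_reduce_edges P b₀ b₁ c₀ c₁ a h
  have h₁ := h.congr_fun hD₁ measurableSet_triangle
  obtain ⟨D₂, hD₂⟩ := exists_reduce_edge_one D₁ b₀ c₀ c₁ h₁
  have h₂ := h₁.congr_fun hD₂ measurableSet_triangle
  rw [setIntegral_congr_fun measurableSet_triangle hD₁,
    setIntegral_congr_fun measurableSet_triangle hD₂]
  exact integral_mem_of_orders D₂ b₀ c₁ (fun i j hij => coeff_eq_zero_of_corner D₂ b₀ c₁ h₂ hij)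
    (fun i j hij => coeff_sigma_eq_zero_of_corner D₂ b₀ c₁ h₂ hij)

/-- The polynomial `P ∈ ℚ[y][x]` attached to `p : MvPolynomial (Fin 2) ℚ` (`X 0 ↦ y = C X`,
`X 1 ↦ x = X`) has the same values: `p(t₀, t₁) = P_{t₀}(t₁)`. [folklore] -/
theorem aeval_eq_eval_section (p : MvPolynomial (Fin 2) ℚ) (t : Fin 2 → ℝ) :
    MvPolynomial.aeval t p =
      ((MvPolynomial.aeval (fun k : Fin 2 => if k = 0 then C X else (X : ℚ[X][X])) p).map
        (eval₂RingHom (algebraMap ℚ ℝ) (t 0))).eval (t 1) := by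
  induction p using MvPolynomial.induction_on with
  | C c =>
    rw [MvPolynomial.aeval_C, MvPolynomial.aeval_C, Polynomial.algebraMap_apply, Polynomial.map_C,
      eval_C, coe_eval₂RingHom, Polynomial.algebraMap_eq, eval₂_C]
  | add p q hp hq => rw [map_add, map_add, Polynomial.map_add, eval_add, hp, hq]
  | mul_X p k hp =>
    rw [map_mul, map_mul, Polynomial.map_mul, eval_mul, hp, MvPolynomial.aeval_X,
      MvPolynomial.aeval_X]
    congr 1
    fin_cases k
    · simp
    · simp

/-- `StrictAnti` for a pair. [folklore] -/
theorem strictAnti_fin_two_iff (t : Fin 2 → ℝ) : StrictAnti t ↔ t 1 < t 0 := by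
  constructor
  · intro h
    exact h (show (0 : Fin 2) < 1 from Fin.zero_lt_one)
  · intro h i j hij
    fin_cases i <;> fin_cases j
    · exact absurd hij (lt_irrefl _)
    · exact h
    · exact absurd hij (by decide)
    · exact absurd hij (lt_irrefl _)

/-- **Brown's theorem in dimension `2` (`𝔐_{0,5}`, the pentagon).** An absolutely convergent
`∫∫_{1 > t₀ > t₁ > 0} P(t)/(t₀^{b₀} t₁^{b₁} (1-t₀)^{c₀} (1-t₁)^{c₁} (t₀-t₁)^{a₀₁}) dt`,
`P ∈ ℚ[t₀, t₁]`, is a rational linear combination of `1` and `ζ(2)`, i.e. lies in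
`𝒵₀ + 𝒵₁ + 𝒵₂ = ℚ + ℚ ζ(2)`. This is the case `ℓ = 2` of `GenusZeroPeriodsMZV`
[Brown 2009, Thm 1.1, Cor 8.3]: absolute convergence is equivalent to the absence of poles along
the five sides of the pentagon `X̄₅ ⊂ 𝔐̄_{0,5}(ℝ)` — the three edges of the triangle and the two
exceptional divisors over its corners `(0,0)`, `(1,1)` (Lemma 7.4 / 4.9; here
`exists_reduce_edges`, `exists_reduce_edge_one`, `coeff_eq_zero_of_corner`) — which makes the
integrand a rational combination of dihedral monomials (Lemma 7.4), each integrating to an element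
of `ℚ + ℚ ζ(2)` (Thm 8.2, here `integral_monomial_mem`).
[cite: BrownENS2009, Thm 1.1 and Cor 8.3] -/
theorem integral_mem_iSup_mzvSpace_two (p : MvPolynomial (Fin 2) ℚ) (a : Fin 2 → Fin 2 → ℕ)
    (b c : Fin 2 → ℕ)
    (h : IntegrableOn (fun t : Fin 2 → ℝ => MvPolynomial.aeval t p /
        ((∏ i, t i ^ b i) * (∏ i, (1 - t i) ^ c i) *
          ∏ i, ∏ j, if i < j then (t i - t j) ^ a i j else 1))
      (KZ.openOrderedSimplex 2) volume) :
    (∫ t in KZ.openOrderedSimplex 2, MvPolynomial.aeval t p /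
        ((∏ i, t i ^ b i) * (∏ i, (1 - t i) ^ c i) *
          ∏ i, ∏ j, if i < j then (t i - t j) ^ a i j else 1)) ∈
      ⨆ (w : ℕ) (_ : w ≤ 2), mzvSpace w := by
  set P : ℚ[X][X] := MvPolynomial.aeval (fun k : Fin 2 => if k = 0 then C X else (X : ℚ[X][X])) p
    with hP
  set F : ℝ × ℝ → ℝ := fun q => (P.map (eval₂RingHom (algebraMap ℚ ℝ) q.1)).eval q.2 /
    (q.1 ^ b 0 * q.2 ^ b 1 * (1 - q.1) ^ c 0 * (1 - q.2) ^ c 1 * (q.1 - q.2) ^ a 0 1) with hF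
  set f : (Fin 2 → ℝ) → ℝ := fun t => MvPolynomial.aeval t p /
        ((∏ i, t i ^ b i) * (∏ i, (1 - t i) ^ c i) *
          ∏ i, ∏ j, if i < j then (t i - t j) ^ a i j else 1) with hf
  set e := (MeasurableEquiv.finTwoArrow : (Fin 2 → ℝ) ≃ᵐ ℝ × ℝ) with he_def
  have hmp : MeasurePreserving e volume volume := volume_preserving_finTwoArrow ℝ
  have hemb : MeasurableEmbedding e := e.measurableEmbedding
  have he : ∀ t, e t = (t 0, t 1) := fun t => rfl
  have hpre : e ⁻¹' {p : ℝ × ℝ | 0 < p.2 ∧ p.2 < p.1 ∧ p.1 < 1} = KZ.openOrderedSimplex 2 := by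
    ext t
    simp only [mem_preimage, he, mem_setOf_eq, KZ.openOrderedSimplex, Fin.forall_fin_two,
      strictAnti_fin_two_iff]
    constructor
    · rintro ⟨h1, h2, h3⟩
      exact ⟨⟨by linarith, h1⟩, ⟨h3, by linarith⟩, h2⟩
    · rintro ⟨⟨h1, h2⟩, ⟨h3, h4⟩, h5⟩
      exact ⟨h2, h5, h3⟩
  have hfF : ∀ t, f t = F (e t) := by
    intro t
    simp only [hf, hF, he, Fin.prod_univ_two, Fin.isValue, lt_self_iff_false, if_false,
      show (0 : Fin 2) < 1 from Fin.zero_lt_one, if_true, show ¬ (1 : Fin 2) < 0 by decide,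
      mul_one, one_mul, aeval_eq_eval_section p t]
    ring
  have hint : IntegrableOn F {p : ℝ × ℝ | 0 < p.2 ∧ p.2 < p.1 ∧ p.1 < 1} volume := by
    refine (hmp.integrableOn_comp_preimage hemb (f := F)
      (s := {p : ℝ × ℝ | 0 < p.2 ∧ p.2 < p.1 ∧ p.1 < 1})).1 ?_
    rw [hpre]
    exact h.congr_fun (fun t _ => hfF t) (KZ.measurableSet_openOrderedSimplex 2)
  have hval : (∫ t in KZ.openOrderedSimplex 2, f t) =
      ∫ q in {p : ℝ × ℝ | 0 < p.2 ∧ p.2 < p.1 ∧ p.1 < 1}, F q := by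
    rw [← hmp.setIntegral_preimage_emb hemb F {p : ℝ × ℝ | 0 < p.2 ∧ p.2 < p.1 ∧ p.1 < 1}, hpre]
    exact setIntegral_congr_fun (KZ.measurableSet_openOrderedSimplex 2) fun t _ => hfF t
  rw [hval]
  exact integral_mem_of_integrableOn P (b 0) (b 1) (c 0) (c 1) (a 0 1) hint

/-- **Brown's theorem in dimensions `≤ 2`**: the cases `ℓ = 0, 1, 2` of the named fact
`GenusZeroPeriodsMZV` — an absolutely convergent integral over the standard cell of a regular
function on `𝔐_{0,ℓ+3}` lies in `∑_{w ≤ ℓ} 𝒵_w` — proved (`ℓ ≤ 1`: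
`GenusZeroPeriodsMZVLowDimProofs`; `ℓ = 2`: this file). [Brown 2009, Thm 1.1, Cor 8.3]
[cite: BrownENS2009, Thm 1.1 and Cor 8.3] -/
theorem integral_mem_iSup_mzvSpace_of_le_two (ℓ : ℕ) (hℓ : ℓ ≤ 2) (p : MvPolynomial (Fin ℓ) ℚ)
    (a : Fin ℓ → Fin ℓ → ℕ) (b c : Fin ℓ → ℕ)
    (h : IntegrableOn (fun t : Fin ℓ → ℝ => MvPolynomial.aeval t p /
        ((∏ i, t i ^ b i) * (∏ i, (1 - t i) ^ c i) *
          ∏ i, ∏ j, if i < j then (t i - t j) ^ a i j else 1))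
      (KZ.openOrderedSimplex ℓ) volume) :
    (∫ t in KZ.openOrderedSimplex ℓ, MvPolynomial.aeval t p /
        ((∏ i, t i ^ b i) * (∏ i, (1 - t i) ^ c i) *
          ∏ i, ∏ j, if i < j then (t i - t j) ^ a i j else 1)) ∈
      ⨆ (w : ℕ) (_ : w ≤ ℓ), mzvSpace w := by
  interval_cases ℓ
  · exact integral_mem_iSup_mzvSpace_zero p a b c
  · exact integral_mem_iSup_mzvSpace_one p a b c h
  · exact integral_mem_iSup_mzvSpace_two p a b c h

end GenusZeroPeriodsMZV

end Literature.NumberTheory.Transcendental
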